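import Mathlib
import Literature.NumberTheory.Automorphic.ShimuraCurve
import Literature.NumberTheory.Automorphic.QuaternionAlgebraAdelicSplitProofs
import Literature.NumberTheory.Automorphic.QuaternionAlgebraAdelicMatrixProofs
import Literature.NumberTheory.Automorphic.QuaternionAlgebraAdelicRamificationProofs
import Literature.NumberTheory.Automorphic.JordanZassenhaus
import HarnessLib

/-!
# Shimura curve data with `D > 1`: the algebra is a division algebra, and `ι(O)` is a lattice in
# `M₂(ℝ)` to which Minkowski's theorem applies

Theorems only (no definition, no named fact). First half of the proof that the Fuchsian group
`Γ₀^D(M) = ι(O¹)` of a Shimura curve datum `X : ShimuraCurveData D M`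
(`Literature/NumberTheory/Automorphic/ShimuraCurve.lean`) is COCOMPACT when `D > 1` (Vignéras,
LNM 800, Ch. IV §1 Thm. 1.1: `φ(O¹)` "est cocompact si `H` est un corps"; Shimura 1971, Prop. 9.3),
the geometric input of the named fact
`Literature.NumberTheory.Automorphic.shimuraCurve_pet_pos_ae_and_log_integrable`
(`ShimuraCurveAnalytic.lean`). The printed proofs are adelic (Fujisaki's compactness of
`H¹_K ∖ H¹_𝔸`, Vignéras III.1.4 / Weil); we give the direct geometry-of-numbers argument, of which
this file contains:

1. `ShimuraCurveData.isUnit_of_ne_zero` — for `1 < D` the quaternion algebra `X.B` is a division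
   algebra: by Wedderburn–Artin (Mathlib `IsSimpleRing.exists_algEquiv_matrix_divisionRing_finite`)
   it is `E` or `M₂(ℚ)`, and `M₂(ℚ)` is split at every finite place (tree `isSplitAt_matrix`)
   whereas `Ram(X.B) = {p ∣ D} ≠ ∅`.
2. `ShimuraCurveData.exists_basis_real` — a `ℤ`-basis of the order `O` is mapped by the real
   splitting `ι` to an `ℝ`-basis of `M₂(ℝ)` (`ℝ ⊗_ℚ B` is simple, tree
   `IsSimpleRing.tensorProduct_of_isCentral'`, so `ℝ ⊗_ℚ B → M₂(ℝ)` is injective, and bijective by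
   dimension); i.e. `ι(O)` is a full lattice in `M₂(ℝ) ≅ ℝ⁴`.
3. `ShimuraCurveData.exists_forall_det_one_exists_mem_order` — MINKOWSKI STEP: there is `r` such
   that for every real `g` with `det g = 1` some `x ∈ O ∖ 0` has all entries of `ι(x) g` bounded by
   `r` (Mathlib `exists_ne_zero_mem_lattice_of_measure_mul_two_pow_lt_measure` for the lattice
   `ι(O) g`, whose covolume does not depend on `g` since `det (A ↦ A g) = det(g)² = 1`).

The second half (finiteness of the classes `x O¹` and the compact set) is
`ShimuraCurveCocompact.lean`.

## References

* M.-F. Vignéras, *Arithmétique des algèbres de quaternions*, LNM 800 (1980), Ch. IV §1 Thm. 1.1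
  (PDF p. 89 of the held copy). [VignerasLNM800]
* G. Shimura, *Introduction to the arithmetic theory of automorphic functions* (1971), §9.2,
  Thm. 9.1 and Prop. 9.2–9.3 (PDF pp. 278–281). [ShimuraIATAF1971]
-/

noncomputable section

open scoped MatrixGroups TensorProduct Pointwise
open _root_.MeasureTheory Set Filter

namespace Literature.NumberTheory.Automorphic

namespace ShimuraCurveData

variable {D M : ℕ} (X : ShimuraCurveData D M)

/-- **For `D > 1` the quaternion algebra of a Shimura curve datum is a division algebra.** By
Wedderburn–Artin (Mathlib `IsSimpleRing.exists_algEquiv_matrix_divisionRing_finite`) the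
`4`-dimensional central simple `ℚ`-algebra `X.B` is `M_k(E)` with `E` a division algebra and
`k² dim E = 4`; if `k = 2` then `X.B ≃ M₂(ℚ)` is split at every finite place
(`isSplitAt_matrix`), contradicting `Ram(X.B) = {p ∣ D} ∋ p` for a prime `p ∣ D`; so `k = 1` and
`X.B ≃ E`. (Vignéras III §3: `Ram(H) = ∅ ⇔ H ≃ M(2, K)`.) [folklore] -/
theorem isUnit_of_ne_zero (hD : 1 < D) (x : X.B) (hx : x ≠ 0) : IsUnit x := by
  classical
  haveI := IsQuaternionAlgebra.isSimpleRing' ℚ X.B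
  haveI : IsArtinianRing X.B := IsArtinianRing.of_finite ℚ X.B
  have h4 := IsQuaternionAlgebra.finrank_eq_four (K := ℚ) (D := X.B)
  obtain ⟨k, hk, E, _, _, _, ⟨e⟩⟩ :=
    IsSimpleRing.exists_algEquiv_matrix_divisionRing_finite ℚ X.B
  have hdim : k * k * Module.finrank ℚ E = 4 := by
    rw [← h4, e.toLinearEquiv.finrank_eq, Module.finrank_matrix, Fintype.card_fin]
  have hE : 0 < Module.finrank ℚ E := Module.finrank_pos
  have hkle : k ≤ 4 :=
    (Nat.le_mul_self k).trans ((Nat.le_mul_of_pos_right _ hE).trans hdim.le)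
  interval_cases k
  · simp at hdim
  · -- `X.B ≃ M₁(E) = E` is a division algebra
    have hy' : e x ≠ 0 := by simpa using hx
    have h00 : e x 0 0 ≠ 0 := by
      intro h0
      apply hy'
      ext i j
      rw [Subsingleton.elim i 0, Subsingleton.elim j 0, h0]
      rfl
    have hsc : Matrix.scalar (Fin 1) (e x 0 0) = e x := by
      ext i j
      rw [Subsingleton.elim i 0, Subsingleton.elim j 0]
      simp
    have hu : IsUnit (e x) := hsc ▸ (isUnit_iff_ne_zero.mpr h00).map (Matrix.scalar (Fin 1))
    simpa using hu.map e.symm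
  · -- `dim E = 1`, `X.B ≃ M₂(ℚ)` is split everywhere: impossible for `D > 1`
    exfalso
    have hE1 : Module.finrank ℚ E = 1 := by omega
    obtain ⟨-, hsurj⟩ := Algebra.finrank_eq_one_iff_bijective_algebraMap.mp hE1
    let eEK : E ≃ₐ[ℚ] ℚ :=
      (AlgEquiv.ofBijective (Algebra.ofId ℚ E) ⟨(algebraMap ℚ E).injective, hsurj⟩).symm
    let e' : X.B ≃ₐ[ℚ] Matrix (Fin 2) (Fin 2) ℚ := e.trans eEK.mapMatrix
    obtain ⟨p, hp, hpD⟩ := Nat.exists_prime_and_dvd hD.ne'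
    set v := (Rat.HeightOneSpectrum.primesEquiv (R := NumberField.RingOfIntegers ℚ)).symm ⟨p, hp⟩
      with hv
    have hmem : v ∈ ramifiedPlaces ℚ X.B := by
      rw [X.ramifiedPlaces_eq]
      show ((Rat.HeightOneSpectrum.primesEquiv v : Nat.Primes) : ℕ) ∣ D
      rw [hv, Equiv.apply_symm_apply]
      exact hpD
    exact hmem (IsSplitAt.of_algEquiv ℚ X.B e' v (isSplitAt_matrix ℚ v))
  · omega
  · omega

/-- The algebra of a datum is non-trivial (it is a simple ring). [folklore] -/
theorem nontrivial_B : Nontrivial X.B := by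
  haveI := IsQuaternionAlgebra.isSimpleRing' ℚ X.B
  infer_instance

/-- The algebra of a datum has characteristic zero (it is a non-trivial `ℚ`-algebra). [folklore] -/
theorem charZero_B : CharZero X.B := by
  haveI := X.nontrivial_B
  exact charZero_of_injective_algebraMap (algebraMap ℚ X.B).injective

/-- **A `ℤ`-basis of the order `O` is an `ℝ`-basis of `M₂(ℝ)` under the real splitting `ι`.**
If `X.B` is a division algebra, `O` is a free `ℤ`-module (finitely generated, torsion-free); a
`ℤ`-basis `b` of `O` is a `ℚ`-basis of `B` (`O` is a full lattice), hence `1 ⊗ b` is an `ℝ`-basis of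
`ℝ ⊗_ℚ B`; the `ℝ`-algebra map `ℝ ⊗_ℚ B → M₂(ℝ)` induced by `ι` is injective because `ℝ ⊗_ℚ B` is
simple (`B` central simple; tree `IsSimpleRing.tensorProduct_of_isCentral'`) and bijective by
dimension (`4 = 4`), so it maps this basis to an `ℝ`-basis `i ↦ ι (b i)` of `M₂(ℝ)`. In particular
`ι(O)` is a full `ℤ`-lattice in `M₂(ℝ)` (Vignéras IV §1). [folklore] -/
theorem exists_basis_real (hdiv : ∀ x : X.B, x ≠ 0 → IsUnit x) :
    ∃ (n : ℕ) (b : Module.Basis (Fin n) ℤ X.O)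
      (b' : Module.Basis (Fin n) ℝ (Matrix (Fin 2) (Fin 2) ℝ)), ∀ i, b' i = X.ι (b i) := by
  classical
  haveI := X.nontrivial_B
  haveI := X.charZero_B
  haveI : IsAddTorsionFree X.B := isAddTorsionFree_of_forall_isUnit hdiv
  haveI : Module.Finite ℤ X.O := Module.Finite.iff_fg.mpr X.isOrder.isFullLattice.1
  haveI : IsAddTorsionFree X.O := X.O.toAddSubgroup.instIsAddTorsionFree
  let b := Module.finBasis ℤ X.O
  set v : Fin (Module.finrank ℤ X.O) → X.B := fun i => (b i : X.B) with hv
  -- `b` is a `ℚ`-basis of `B`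
  have hli : LinearIndependent ℚ v := by
    rw [← LinearIndependent.iff_fractionRing ℤ ℚ]
    exact b.linearIndependent.map' X.O.subtype (Submodule.ker_subtype _)
  have hsp : ⊤ ≤ Submodule.span ℚ (Set.range v) := by
    intro d _
    obtain ⟨n, hn, hnd⟩ := X.isOrder.isFullLattice.2 d
    have h1 : (n • d) ∈ Submodule.span ℤ (Set.range v) := by
      have hmem : (⟨n • d, hnd⟩ : X.O) ∈ Submodule.span ℤ (Set.range b) := by
        rw [b.span_eq]; trivial
      have h2 := Submodule.mem_map_of_mem (f := X.O.subtype) hmem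
      rw [Submodule.map_span, ← Set.range_comp] at h2
      exact h2
    have h3 : (n • d) ∈ Submodule.span ℚ (Set.range v) :=
      Submodule.span_le_restrictScalars ℤ ℚ _ h1
    have h4 : d = (n : ℚ)⁻¹ • (n • d) := by
      rw [← Int.cast_smul_eq_zsmul ℚ n d, inv_smul_smul₀ (Int.cast_ne_zero.mpr hn)]
    rw [h4]
    exact Submodule.smul_mem _ _ h3
  let β : Module.Basis (Fin (Module.finrank ℤ X.O)) ℚ X.B := Module.Basis.mk hli hsp
  have hβ : ∀ i, β i = (b i : X.B) := fun i => by rw [Module.Basis.mk_apply]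
  -- the real scalar extension of `ι`
  haveI := IsQuaternionAlgebra.isSimpleRing' ℚ X.B
  haveI hs : IsSimpleRing (ℝ ⊗[ℚ] X.B) := IsSimpleRing.tensorProduct_of_isCentral'
  let ιℝ : ℝ ⊗[ℚ] X.B →ₐ[ℝ] Matrix (Fin 2) (Fin 2) ℝ :=
    Algebra.TensorProduct.lift (Algebra.ofId ℝ _) X.ι (fun r y => Algebra.commutes r (X.ι y))
  have hinj : Function.Injective ιℝ.toLinearMap := RingHom.injective ιℝ.toRingHom
  have hdim : Module.finrank ℝ (ℝ ⊗[ℚ] X.B) = Module.finrank ℝ (Matrix (Fin 2) (Fin 2) ℝ) := by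
    rw [Module.finrank_baseChange, IsQuaternionAlgebra.finrank_eq_four (K := ℚ) (D := X.B),
      Module.finrank_matrix]
    simp
  let e := ιℝ.toLinearMap.linearEquivOfInjective hinj hdim
  let ℰ := Algebra.TensorProduct.basis ℝ β
  refine ⟨Module.finrank ℤ X.O, b, ℰ.map e, fun i => ?_⟩
  rw [Module.Basis.map_apply, Algebra.TensorProduct.basis_apply,
    LinearMap.linearEquivOfInjective_apply, AlgHom.toLinearMap_apply,
    Algebra.TensorProduct.lift_tmul, map_one, one_mul, hβ]

/-- **Minkowski step.** If `X.B` is a division algebra there is `r` such that for every real matrix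
`g` of determinant `1` some non-zero `x ∈ O` has all entries of `ι(x) g` bounded by `r` in absolute
value: `ι(O) g` is a full lattice in `M₂(ℝ) ≅ ℝ⁴` of covolume independent of `g` (right
multiplication by `g` has determinant `det(g)² = 1`), and Minkowski's convex body theorem (Mathlib
`exists_ne_zero_mem_lattice_of_measure_mul_two_pow_lt_measure`) applies to a fixed cube. [folklore] -/
theorem exists_forall_det_one_exists_mem_order (hdiv : ∀ x : X.B, x ≠ 0 → IsUnit x) :
    ∃ r : ℝ, ∀ g : Matrix (Fin 2) (Fin 2) ℝ, g.det = 1 →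
      ∃ x ∈ X.O, x ≠ 0 ∧ ∀ i j, |(X.ι x * g) i j| ≤ r := by
  classical
  obtain ⟨n, b, b', hb'⟩ := X.exists_basis_real hdiv
  -- transport to `E := Fin 2 → Fin 2 → ℝ` (rows), which carries the sup norm and Lebesgue measure
  let eM : Matrix (Fin 2) (Fin 2) ℝ ≃ₗ[ℝ] (Fin 2 → Fin 2 → ℝ) := (Matrix.ofLinearEquiv ℝ).symm
  let bE : Module.Basis (Fin n) ℝ (Fin 2 → Fin 2 → ℝ) := b'.map eM
  obtain ⟨R, hR0, hR⟩ := (ZSpan.fundamentalDomain_isBounded bE).subset_closedBall_lt 0 0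
  refine ⟨4 * R, fun g hg => ?_⟩
  -- right multiplication by `g`, row by row
  let Rg : (Fin 2 → Fin 2 → ℝ) →ₗ[ℝ] (Fin 2 → Fin 2 → ℝ) :=
    LinearMap.pi fun i => (Matrix.toLin' g.transpose).comp (LinearMap.proj i)
  have hRg : ∀ A : Fin 2 → Fin 2 → ℝ, Rg A = fun i j => (Matrix.of A * g) i j := by
    intro A
    funext i j
    simp [Rg, Matrix.mul_apply, Matrix.mulVec, dotProduct, mul_comm]
  have hdet : LinearMap.det Rg = 1 := by
    rw [LinearMap.det_pi]
    simp [LinearMap.det_toLin', Matrix.det_transpose, hg]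
  let Rge : (Fin 2 → Fin 2 → ℝ) ≃ₗ[ℝ] (Fin 2 → Fin 2 → ℝ) :=
    LinearMap.equivOfDetNeZero Rg (by rw [hdet]; exact one_ne_zero)
  have hRge : ∀ A, Rge A = Rg A := fun A => rfl
  let bg : Module.Basis (Fin n) ℝ (Fin 2 → Fin 2 → ℝ) := bE.map Rge
  -- the lattice `ι(O) g` and its covolume
  set μ : Measure (Fin 2 → Fin 2 → ℝ) := volume with hμ
  have hfund := ZSpan.isAddFundamentalDomain' bg μ
  haveI : Countable (Submodule.span ℤ (Set.range bg)).toAddSubgroup := by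
    change Countable (Submodule.span ℤ (Set.range bg))
    infer_instance
  have hμg : μ (ZSpan.fundamentalDomain bg) = μ (ZSpan.fundamentalDomain bE) := by
    rw [ZSpan.measure_fundamentalDomain bg μ bE]
    have : bE.det bg = 1 := by
      have e1 : (bg : Fin n → (Fin 2 → Fin 2 → ℝ)) = (Rge : (Fin 2 → Fin 2 → ℝ) →ₗ[ℝ] _) ∘ bE := by
        funext i; simp [bg]
      have hRgeL : (Rge : (Fin 2 → Fin 2 → ℝ) →ₗ[ℝ] (Fin 2 → Fin 2 → ℝ)) = Rg :=
        LinearEquiv.coe_ofIsUnitDet _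
      rw [e1, Module.Basis.det_comp, Module.Basis.det_self, mul_one, hRgeL, hdet]
    rw [this, abs_one, ENNReal.ofReal_one, one_mul]
  -- Minkowski
  have hsymm : ∀ x ∈ Metric.closedBall (0 : Fin 2 → Fin 2 → ℝ) (4 * R), -x ∈
      Metric.closedBall (0 : Fin 2 → Fin 2 → ℝ) (4 * R) := by
    intro x hx
    simpa [mem_closedBall_zero_iff, norm_neg] using hx
  have hconv : Convex ℝ (Metric.closedBall (0 : Fin 2 → Fin 2 → ℝ) (4 * R)) :=
    convex_closedBall _ _
  have hlt : μ (ZSpan.fundamentalDomain bg) * 2 ^ Module.finrank ℝ (Fin 2 → Fin 2 → ℝ) <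
      μ (Metric.closedBall (0 : Fin 2 → Fin 2 → ℝ) (4 * R)) := by
    rw [hμg]
    have hd0 : Module.finrank ℝ (Fin 2 → Fin 2 → ℝ) ≠ 0 := Module.finrank_pos.ne'
    have hballtop : μ (Metric.closedBall (0 : Fin 2 → Fin 2 → ℝ) R) ≠ ⊤ :=
      measure_closedBall_lt_top.ne
    have hball0 : μ (Metric.closedBall (0 : Fin 2 → Fin 2 → ℝ) R) ≠ 0 :=
      (Metric.measure_closedBall_pos μ _ hR0).ne'
    calc μ (ZSpan.fundamentalDomain bE) * 2 ^ Module.finrank ℝ (Fin 2 → Fin 2 → ℝ)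
        ≤ μ (Metric.closedBall (0 : Fin 2 → Fin 2 → ℝ) R) * 2 ^ Module.finrank ℝ (Fin 2 → Fin 2 → ℝ) := by
          gcongr
      _ < μ (Metric.closedBall (0 : Fin 2 → Fin 2 → ℝ) R) * 4 ^ Module.finrank ℝ (Fin 2 → Fin 2 → ℝ) := by
          rw [mul_comm _ ((2 : ENNReal) ^ _), mul_comm _ ((4 : ENNReal) ^ _)]
          exact ENNReal.mul_lt_mul_left hball0 hballtop (ENNReal.pow_lt_pow_left hd0 (by norm_num))
      _ = μ (Metric.closedBall (0 : Fin 2 → Fin 2 → ℝ) (4 * R)) := by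
          rw [Measure.addHaar_closedBall_mul μ (0 : Fin 2 → Fin 2 → ℝ) (by norm_num : (0:ℝ) ≤ 4)
            hR0.le, mul_comm, ENNReal.ofReal_pow (by norm_num : (0:ℝ) ≤ 4)]
          norm_num
  obtain ⟨⟨v, hv⟩, hv0, hvs⟩ :=
    exists_ne_zero_mem_lattice_of_measure_mul_two_pow_lt_measure hfund hsymm hconv hlt
  have hv' : v ∈ Submodule.span ℤ (Set.range bg) := hv
  rw [Submodule.mem_span_range_iff_exists_fun] at hv'
  obtain ⟨c, hc⟩ := hv'
  set x : X.O := ∑ i, c i • b i with hx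
  -- `v = ι(x) g`
  have hbg : ∀ i, bg i = Rg (eM (X.ι (b i))) := by
    intro i
    simp [bg, bE, hRge, hb']
  have hvx : v = Rg (eM (X.ι (x : X.B))) := by
    rw [← hc, hx]
    simp only [hbg, Submodule.coe_sum, Submodule.coe_smul_of_tower, map_sum, map_zsmul]
  have hvx' : ∀ i j, v i j = (X.ι (x : X.B) * g) i j := by
    intro i j
    rw [hvx, hRg]
    rfl
  refine ⟨x, x.2, ?_, fun i j => ?_⟩
  · intro h0
    apply hv0
    have : x = 0 := Subtype.ext h0
    apply Subtype.ext
    show v = 0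
    rw [hvx, this]
    simp
  · rw [← hvx']
    have h1 : ‖v‖ ≤ 4 * R := mem_closedBall_zero_iff.mp hvs
    have h2 : ‖v i j‖ ≤ ‖v‖ := (norm_le_pi_norm (v i) j).trans (norm_le_pi_norm v i)
    rw [Real.norm_eq_abs] at h2
    exact h2.trans h1

end ShimuraCurveData

end Literature.NumberTheory.Automorphic
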